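import Literature.AlgebraicGeometry.AbelianSchemes.AbelianSchemeOverBase
import Literature.AlgebraicGeometry.AbelianSchemes.AbelianSchemeOverField
import Literature.AlgebraicGeometry.AbelianSchemes.AbelianSchemeOverRigidity
import Mathlib.AlgebraicGeometry.Geometrically.Irreducible
import Mathlib.AlgebraicGeometry.Morphisms.UniversallyOpen
import HarnessLib

/-!
# The total space of an abelian scheme over an integral base is integral

Topic `AlgebraicGeometry/AbelianSchemes`; namespace `Literature.AlgebraicGeometry.AbelianSchemes.AbelianSchemeOver`.
THEOREMS ONLY (no definition, no named fact, no instance, no notation, no `sorry`; net Literature debt 0).  Cell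
hodgecm-mathlib (D-0151), HECKE-LINK line, socket (B) coverage chain (cov-3) brick **(B4)** (B-plan1 (g15) 23:31:31Z /
23:40:35Z): for an abelian scheme `A → S`,
* (inside `irreducibleSpace_left`) `A → S` is GEOMETRICALLY IRREDUCIBLE (fibrewise: the fibre over `κ(s)` is the abelian
  scheme ★ `A.fibre (S.fromSpecResidueField s)` over a field, geometrically irreducible by ★
  `AbelianScheme.geometricallyIrreducible_hom`; Mathlib `GeometricallyIrreducible.iff_geometricallyIrreducible_fiber`);
* `irreducibleSpace_left` — over an IRREDUCIBLE base the total space is irreducible (open surjective map with irreducible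
  fibres, Stacks 004Z = Mathlib `GeometricallyIrreducible.irreducibleSpace`; openness = ★ `universallyOpen_hom`,
  `AbelianSchemeOverRigidity`);
* **`isIntegral_left`** — over an INTEGRAL locally Noetherian base the total space `A` is an integral scheme (with ★
  `isReduced_left`, `AbelianSchemeOverHomOfReduced`: smooth over reduced, Stacks 034E).
Consumer: (B5) quasi-projectivity of the dual family / `hcov′` (B-p10 (g10)), via ★
`isQuasiProjectiveOver_of_isFinite_of_surjective … [IsIntegral S''.left] [IsIntegral S.left]`.  HC_CM is proved only modulo
the 7 printed citations until rung 0 closes; this file discharges none of them.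

## References
* [StacksProject] The Stacks Project, Tag 004Z (irreducibility from an open map with irreducible fibres), Tag 01UA (flat +
  locally of finite presentation ⇒ universally open), Tag 034E (smooth over reduced), Tag 056S.
* [GortzWedhorn2020] U. Görtz, T. Wedhorn, *Algebraic Geometry I*, 2nd ed. (2020), Cor. 16.52 (p. 677), Remark 16.54 (p. 678).
* [MumfordFogartyKirwan1994] D. Mumford, J. Fogarty, F. Kirwan, *Geometric Invariant Theory*, 3rd ed. (1994), Ch. 6 §1
  Def. 6.1 (p. 115).
-/

set_option autoImplicit false

noncomputable section

universe u

open CategoryTheory CategoryTheory.Limits AlgebraicGeometry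

namespace Literature.AlgebraicGeometry.AbelianSchemes

namespace AbelianSchemeOver

variable {S : Scheme.{u}} (A : AbelianSchemeOver S)

/-- **Over an irreducible base the total space of an abelian scheme is irreducible** (open surjective structure map with
irreducible fibres). [cite: StacksProject, Tag 004Z] [cite: MumfordFogartyKirwan1994, Ch. 6 §1 Definition 6.1 (p. 115)] -/
theorem irreducibleSpace_left [IrreducibleSpace S] : IrreducibleSpace A.X.left := by
  -- `A → S` is geometrically irreducible: read fibrewise, each fibre `A ×_S Spec κ(s)` is the abelian scheme
  -- `A.fibre (S.fromSpecResidueField s)` over a field (★ `AbelianScheme.geometricallyIrreducible_hom`)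
  haveI : GeometricallyIrreducible A.X.hom := by
    rw [GeometricallyIrreducible.iff_geometricallyIrreducible_fiber]
    intro s
    exact (A.fibre (S.fromSpecResidueField s)).geometricallyIrreducible_hom
  haveI := A.universallyOpen_hom
  exact GeometricallyIrreducible.irreducibleSpace A.X.hom A.X.hom.isOpenMap

/-- **(B4) Over an integral locally Noetherian base the total space `A` of an abelian scheme `A → S` is an INTEGRAL
scheme** (irreducible + reduced). [cite: StacksProject, Tag 004Z] [cite: StacksProject, Tag 034E]
[cite: MumfordFogartyKirwan1994, Ch. 6 §1 Definition 6.1 (p. 115)] -/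
theorem isIntegral_left [IsIntegral S] [IsLocallyNoetherian S] : IsIntegral A.X.left :=
  haveI := A.irreducibleSpace_left
  haveI := A.isReduced_left
  isIntegral_of_irreducibleSpace_of_isReduced A.X.left

end AbelianSchemeOver

end Literature.AlgebraicGeometry.AbelianSchemes

end
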